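import Literature.NumberTheory.LFunctions.ExplicitFormulaPsiCharZeros
import HarnessLib

/-!
# The truncated explicit formula for `ψ(x, χ)`: zeros in unit windows and good heights
# (Montgomery–Vaughan Thm. 10.17, Lemma 12.7)

Topic `Literature/NumberTheory/LFunctions`. THEOREMS (everything proved). Second support file of
the discharge of `Literature.NumberTheory.LFunctions.truncatedExplicitFormula_psiChar`
(Montgomery–Vaughan Thm. 12.10). For a primitive character `χ` modulo `q > 1`, uniformly in `q`
(`ℒ(τ) = log q + log(|τ| + 4)`):

* `exists_sum_window_le` — **MV Thm. 10.17 in the form `N(T + 1, χ) − N(T, χ) ≪ log q(T + 2)`**: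
  an absolute `C` with `∑_{ρ ∈ P} m(ρ) ≤ C ℒ(τ)` for every finite set `P` of non-trivial zeros
  (`0 < Re ρ < 1`) with `|Im ρ − τ| ≤ 1/2`; the zeros with `Re ρ ≥ 1/2` lie in the Jensen disc
  `|s − (2 + iτ)| ≤ 81/50` of the tree
  (`Literature.NumberTheory.LFunctions.DirichletDisc.exists_sum_zeroOrder_le_of_subset_closedBall`),
  the others are reflected into the disc of `χ̄` at height `−τ` by `ρ ↦ 1 − ρ`
  (`ExplicitPsiChar.zeroOrder_one_sub_eq_inv`, MV Cor. 10.8);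
* `exists_goodHeight` — **MV Lemma 12.7 / 12.2 (first step)**: an absolute `c₀ > 0` such that
  every `[τ₀, τ₀ + 1]`, `τ₀ ≥ 0`, contains a height `T` with `||Im ρ| − T| ≥ c₀/ℒ(T)` for every
  non-trivial zero `ρ` (pigeonhole on the `≪ ℒ` zeros of the two windows at `±(τ₀ + 1/2)`);
* `sum_order_sdiff_le`, `norm_charZeroSum_sub_le` — the zeros with `T < |Im ρ| ≤ T₁ ≤ T + 1`
  have total multiplicity `≤ 4C ℒ(T + 1/2)` and contribute `≤ (x/T) ∑ m(ρ)` to the truncated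
  sum `∑_{|γ| ≤ T} m(ρ) x^ρ/ρ` (`charZeroSumTrunc`).

## References

* H. L. Montgomery, R. C. Vaughan, *Multiplicative Number Theory I. Classical Theory*, CUP 2007,
  Theorem 10.17, Corollary 10.8, Lemma 12.7, proof of Theorem 12.10. [MontgomeryVaughan2007]
-/

noncomputable section

open Complex Filter Topology Set Metric
open scoped Real

namespace Literature.NumberTheory.LFunctions

namespace ExplicitPsiChar

open DirichletCharacter Literature.NumberTheory.LFunctions.SiegelZero

/-! ### Zeros in a unit window -/

/-- A non-trivial zero with `Re ρ ≥ 1/2` and `|Im ρ − τ| ≤ 1/2` lies in the Jensen disc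
`|s − (2 + iτ)| ≤ 81/50` (`(3/2)² + (1/2)² = 5/2 < (81/50)²`). [folklore] -/
theorem mem_closedBall_of_window {ρ : ℂ} {τ : ℝ} (h1 : 1 / 2 ≤ ρ.re) (h2 : ρ.re < 1)
    (h3 : |ρ.im - τ| ≤ 1 / 2) : ρ ∈ closedBall (2 + (τ : ℂ) * I) (81 / 50) := by
  rw [mem_closedBall, dist_eq_norm, ← sq_le_sq₀ (norm_nonneg _) (by norm_num), Complex.sq_norm,
    Complex.normSq_apply]
  simp only [sub_re, add_re, re_ofNat, mul_re, ofReal_re, I_re, mul_zero, ofReal_im, I_im,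
    mul_one, sub_self, add_zero, sub_im, add_im, im_ofNat, mul_im, zero_add]
  rw [abs_le] at h3
  nlinarith

/-- **Zeros in a unit window, uniformly in `q`** (MV Thm. 10.17: `N(T+1, χ) − N(T, χ) ≪ log qT`):
there is an absolute `C > 0` such that for every `q > 1`, every primitive `χ` mod `q`, every real
`τ` and every finite set `P` of zeros of `L(s, χ)` with `0 < Re ρ < 1`, `|Im ρ − τ| ≤ 1/2`:
`∑_{ρ ∈ P} m(ρ) ≤ C (log q + log(|τ| + 4))`. [cite: MontgomeryVaughan2007, Theorem 10.17] -/
theorem exists_sum_window_le :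
    ∃ C : ℝ, 0 < C ∧ ∀ (q : ℕ) [NeZero q] (χ : DirichletCharacter ℂ q), χ.IsPrimitive → 1 < q →
      ∀ (τ : ℝ) (P : Finset ℂ),
        (∀ ρ ∈ P, χ.LFunction ρ = 0 ∧ 0 < ρ.re ∧ ρ.re < 1 ∧ |ρ.im - τ| ≤ 1 / 2) →
        ∑ ρ ∈ P, (DirichletDisc.zeroOrder χ ρ : ℝ) ≤ C * (Real.log q + Real.log (|τ| + 4)) := by
  obtain ⟨C, hC0, hC⟩ := DirichletDisc.exists_sum_zeroOrder_le_of_subset_closedBall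
    (R := 81 / 50) (by norm_num) (by norm_num)
  refine ⟨2 * C, by positivity, fun q _ χ hprim hq τ P hP ↦ ?_⟩
  classical
  have hχ : χ ≠ 1 := ne_one_of_isPrimitive hprim hq
  have hχ' : χ⁻¹ ≠ 1 := mt inv_eq_one.mp hχ
  rw [← Finset.sum_filter_add_sum_filter_not P (fun ρ : ℂ ↦ (1 / 2 : ℝ) ≤ ρ.re), two_mul, add_mul]
  refine add_le_add ?_ ?_
  · -- right half: directly in the disc of `χ` at height `τ`
    refine hC q χ hχ τ _ fun ρ hρ ↦ ?_
    rw [Finset.mem_filter] at hρ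
    obtain ⟨h0, -, h2, h3⟩ := hP ρ hρ.1
    exact ⟨mem_closedBall_of_window hρ.2 h2 h3, h0⟩
  · -- left half: reflect by `ρ ↦ 1 - ρ` into the disc of `χ⁻¹` at height `-τ`
    have hinj : Set.InjOn (fun ρ : ℂ ↦ 1 - ρ) ↑(P.filter (fun ρ : ℂ ↦ ¬ (1 / 2 : ℝ) ≤ ρ.re)) :=
      fun a _ b _ h ↦ sub_right_injective h
    have heq : ∑ ρ ∈ P.filter (fun ρ : ℂ ↦ ¬ (1 / 2 : ℝ) ≤ ρ.re), (DirichletDisc.zeroOrder χ ρ : ℝ) =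
        ∑ u ∈ (P.filter (fun ρ : ℂ ↦ ¬ (1 / 2 : ℝ) ≤ ρ.re)).image (fun ρ : ℂ ↦ 1 - ρ),
          (DirichletDisc.zeroOrder χ⁻¹ u : ℝ) := by
      rw [Finset.sum_image hinj]
      refine Finset.sum_congr rfl fun ρ hρ ↦ ?_
      obtain ⟨-, h1, h2, -⟩ := hP ρ (Finset.mem_filter.1 hρ).1
      have h := zeroOrder_one_sub_eq_inv hprim hχ (ρ := 1 - ρ)
        (by simp only [sub_re, one_re]; linarith) (by simp only [sub_re, one_re]; linarith)
      rw [sub_sub_cancel] at h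
      rw [h]
    rw [heq, ← abs_neg τ]
    refine hC q χ⁻¹ hχ' (-τ) _ fun u hu ↦ ?_
    obtain ⟨ρ, hρ, rfl⟩ := Finset.mem_image.1 hu
    obtain ⟨h0, h1, h2, h3⟩ := hP ρ (Finset.mem_filter.1 hρ).1
    have hlt : ρ.re < 1 / 2 := not_le.1 (Finset.mem_filter.1 hρ).2
    refine ⟨mem_closedBall_of_window (τ := -τ) ?_ ?_ ?_, ?_⟩
    · simp only [sub_re, one_re]; linarith
    · simp only [sub_re, one_re]; linarith
    · simp only [sub_im, one_im, zero_sub]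
      rw [show -ρ.im - -τ = -(ρ.im - τ) by ring, abs_neg]
      exact h3
    · exact (LFunction_one_sub_eq_zero_iff hprim hχ (ρ := 1 - ρ)
        (by simp only [sub_re, one_re]; linarith) (by simp only [sub_re, one_re]; linarith)).1
        (by rw [sub_sub_cancel]; exact h0)

/-! ### Good heights -/

/-- **Good heights** (MV Lemma 12.7, the character analogue of Lemma 12.2): there is an absolute
`c₀ > 0` such that for every `q > 1`, every primitive `χ` mod `q` and every `τ₀ ≥ 0`, the interval
`[τ₀, τ₀ + 1]` contains a `T` with `||Im ρ| − T| ≥ c₀/(log q + log(|T| + 4))` for every zero `ρ`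
of `L(s, χ)` with `0 < Re ρ < 1` (so `T` and `−T` are both at that distance from every ordinate).
Pigeonhole on `M + 1` equal subintervals, `M ≪ ℒ` the number of zeros in the two windows at
`±(τ₀ + 1/2)`. [cite: MontgomeryVaughan2007, Lemma 12.7] -/
theorem exists_goodHeight :
    ∃ c₀ : ℝ, 0 < c₀ ∧ ∀ (q : ℕ) [NeZero q] (χ : DirichletCharacter ℂ q), χ.IsPrimitive → 1 < q →
      ∀ τ₀ : ℝ, 0 ≤ τ₀ → ∃ T ∈ Icc τ₀ (τ₀ + 1),
        ∀ ρ : ℂ, χ.LFunction ρ = 0 → 0 < ρ.re → ρ.re < 1 →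
          c₀ / (Real.log q + Real.log (|T| + 4)) ≤ |(|ρ.im|) - T| := by
  obtain ⟨C, hC0, hC⟩ := exists_sum_window_le
  refine ⟨1 / (16 * C + 8), by positivity, fun q _ χ hprim hq τ₀ hτ₀ ↦ ?_⟩
  classical
  have hχ : χ ≠ 1 := ne_one_of_isPrimitive hprim hq
  -- the zeros of the two windows (each once) and their number `M`
  set Wset : Set ℂ := {ρ | χ.LFunction ρ = 0 ∧ 0 < ρ.re ∧ ρ.re < 1 ∧
    |(|ρ.im|) - (τ₀ + 1 / 2)| ≤ 1 / 2} with hWset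
  have hWfin : Wset.Finite := by
    refine (lfunctionZeroBox_finite hχ (τ₀ + 1)).subset ?_
    rintro ρ ⟨h0, h1, h2, h3⟩
    refine ⟨h0, h1, h2, ?_⟩
    rw [abs_le] at h3
    linarith
  set W := hWfin.toFinset with hW
  set M : ℕ := W.card with hM
  have hM1 : (0 : ℝ) < M + 1 := by positivity
  -- pigeonhole
  let φ : ℂ → ℕ := fun ρ ↦ ⌊(|ρ.im| - τ₀) * (M + 1)⌋₊
  have hcard : (W.image φ).card < (Finset.range (M + 1)).card := by
    rw [Finset.card_range]
    exact Nat.lt_succ_of_le (Finset.card_image_le.trans le_rfl)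
  obtain ⟨k, hk, hkφ⟩ := Finset.exists_mem_notMem_of_card_lt_card hcard
  rw [Finset.mem_range] at hk
  set T : ℝ := τ₀ + ((k : ℝ) + 1 / 2) / (M + 1) with hT
  have hk1 : (k : ℝ) + 1 ≤ M + 1 := by exact_mod_cast hk
  have hTlo : τ₀ + (1 / 2) / (M + 1) ≤ T := by
    rw [hT]; gcongr; linarith [(k.cast_nonneg : (0 : ℝ) ≤ k)]
  have hThi : T ≤ τ₀ + 1 - (1 / 2) / (M + 1) := by
    rw [hT, add_sub_assoc, add_le_add_iff_left, le_sub_iff_add_le, ← add_div, div_le_one hM1]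
    linarith
  have hδ0 : (0 : ℝ) < (1 / 2) / (M + 1) := by positivity
  have hT0 : 0 ≤ T := by linarith
  refine ⟨T, ⟨by linarith, by linarith⟩, fun ρ h0 h1 h2 ↦ ?_⟩
  -- Step 1: distance `≥ 1/(2(M+1))`
  have hfar : (1 / 2) / ((M : ℝ) + 1) ≤ |(|ρ.im|) - T| := by
    by_cases hwin : |(|ρ.im|) - (τ₀ + 1 / 2)| ≤ 1 / 2
    · have hρW : ρ ∈ W := by
        rw [hW, Set.Finite.mem_toFinset]
        exact ⟨h0, h1, h2, hwin⟩
      have hne : φ ρ ≠ k := fun h ↦ hkφ (Finset.mem_image.2 ⟨ρ, hρW, h⟩)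
      set y : ℝ := (|ρ.im| - τ₀) * (M + 1) with hy
      have hy0 : 0 ≤ y := by
        rw [abs_le] at hwin
        have : 0 ≤ |ρ.im| - τ₀ := by linarith
        positivity
      have hcase : y < k ∨ (k : ℝ) + 1 ≤ y := by
        by_contra hcon
        rw [not_or, not_lt, not_le] at hcon
        exact hne ((Nat.floor_eq_iff hy0).2 ⟨hcon.1, hcon.2⟩)
      have hyT : |ρ.im| - T = (y - (k + 1 / 2)) / (M + 1) := by
        rw [hT, hy]; field_simp; ring
      rw [hyT, abs_div, abs_of_pos hM1, div_le_div_iff_of_pos_right hM1]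
      rcases hcase with h | h
      · rw [abs_of_neg (by linarith)]; linarith
      · rw [abs_of_nonneg (by linarith)]; linarith
    · rw [not_le] at hwin
      have h1' : |T - (τ₀ + 1 / 2)| ≤ 1 / 2 - (1 / 2) / (M + 1) := by
        rw [abs_le]; constructor <;> linarith
      have h2' := abs_sub_abs_le_abs_sub (|ρ.im| - (τ₀ + 1 / 2)) (T - (τ₀ + 1 / 2))
      rw [show |ρ.im| - (τ₀ + 1 / 2) - (T - (τ₀ + 1 / 2)) = |ρ.im| - T by ring] at h2'
      linarith
  -- Step 2: `M ≤ 2C ℒ(τ₀ + 1/2) ≤ 4C ℒ(T)`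
  refine le_trans ?_ hfar
  set ℒ : ℝ := Real.log q + Real.log (|T| + 4) with hℒ
  have hℒ1 : 1 ≤ ℒ := DirichletZFR.one_le_ell q T
  have hMle : (M : ℝ) ≤ 2 * (C * (Real.log q + Real.log (|τ₀ + 1 / 2| + 4))) := by
    have hsum : (M : ℝ) = ∑ ρ ∈ W, (1 : ℝ) := by simp [hM]
    rw [hsum, ← Finset.sum_filter_add_sum_filter_not W (fun ρ : ℂ ↦ 0 ≤ ρ.im), two_mul]
    refine add_le_add ?_ ?_
    · refine le_trans (Finset.sum_le_sum fun ρ hρ ↦ ?_) (hC q χ hprim hq (τ₀ + 1 / 2) _ fun ρ hρ ↦ ?_)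
      · rw [Finset.mem_filter, hW, Set.Finite.mem_toFinset] at hρ
        exact_mod_cast (DirichletDisc.zeroOrder_pos_iff χ hχ ρ).2 hρ.1.1
      · rw [Finset.mem_filter, hW, Set.Finite.mem_toFinset] at hρ
        obtain ⟨⟨h0, h1, h2, h3⟩, him⟩ := hρ
        rw [abs_of_nonneg him] at h3
        exact ⟨h0, h1, h2, h3⟩
    · have habs : |(-(τ₀ + 1 / 2))| = |τ₀ + 1 / 2| := abs_neg _
      have h := hC q χ hprim hq (-(τ₀ + 1 / 2)) (W.filter (fun ρ : ℂ ↦ ¬ 0 ≤ ρ.im)) fun ρ hρ ↦ by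
        rw [Finset.mem_filter, hW, Set.Finite.mem_toFinset, not_le] at hρ
        obtain ⟨⟨h0, h1, h2, h3⟩, him⟩ := hρ
        rw [abs_of_neg him] at h3
        refine ⟨h0, h1, h2, ?_⟩
        rwa [sub_neg_eq_add, show ρ.im + (τ₀ + 1 / 2) = -(-ρ.im - (τ₀ + 1 / 2)) by ring, abs_neg]
      rw [habs] at h
      refine le_trans (Finset.sum_le_sum fun ρ hρ ↦ ?_) h
      rw [Finset.mem_filter, hW, Set.Finite.mem_toFinset] at hρ
      exact_mod_cast (DirichletDisc.zeroOrder_pos_iff χ hχ ρ).2 hρ.1.1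
  have hlogle : Real.log (|τ₀ + 1 / 2| + 4) ≤ 2 * Real.log (|T| + 4) := by
    have h1 : |τ₀ + 1 / 2| ≤ |T| + 1 / 2 := by
      rw [abs_of_nonneg (by linarith), abs_of_nonneg hT0]; linarith
    calc Real.log (|τ₀ + 1 / 2| + 4) ≤ Real.log ((|T| + 4) ^ 2) := by
          refine Real.log_le_log (by positivity) ?_
          nlinarith [abs_nonneg T]
      _ = 2 * Real.log (|T| + 4) := by rw [Real.log_pow]; norm_num
  have hlogq : 0 ≤ Real.log q := Real.log_natCast_nonneg q
  have hℒ0 : 0 < ℒ := by linarith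
  have hM' : (M : ℝ) + 1 ≤ (4 * C + 2) * ℒ := by
    have h4 : Real.log q + Real.log (|τ₀ + 1 / 2| + 4) ≤ 2 * ℒ := by rw [hℒ]; linarith
    have := mul_le_mul_of_nonneg_left h4 hC0.le
    nlinarith
  rw [div_le_div_iff₀ hℒ0 hM1]
  calc 1 / (16 * C + 8) * ((M : ℝ) + 1) ≤ 1 / (16 * C + 8) * ((4 * C + 2) * ℒ) :=
        mul_le_mul_of_nonneg_left hM' (by positivity)
    _ = (1 / 4) * ℒ := by field_simp; ring
    _ ≤ 1 / 2 * ℒ := by nlinarith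

/-- At a good height `T > 0`, both `T` and `−T` are at distance `≥ η` from every ordinate:
`η ≤ ||γ| − T|` implies `η ≤ |γ − T|` and `η ≤ |γ + T|`. [folklore] -/
theorem dist_of_abs_sub_le {γ T η : ℝ} (hT : 0 ≤ T) (h : η ≤ |(|γ|) - T|) :
    η ≤ |γ - T| ∧ η ≤ |γ + T| := by
  constructor
  · refine h.trans ?_
    have := abs_abs_sub_abs_le_abs_sub γ T
    rwa [abs_of_nonneg hT] at this
  · refine h.trans ?_
    have := abs_abs_sub_abs_le_abs_sub γ (-T)
    rwa [abs_neg, abs_of_nonneg hT, sub_neg_eq_add] at this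

/-! ### From `T₁` back to `T` -/

/-- **Zeros between `T` and `T₁ ≤ T + 1`** (MV Thm. 10.17 in the form `N(T+1, χ) − N(T, χ) ≪
log qT`): with `C` the window constant of `exists_sum_window_le`, the non-trivial zeros with
`T < |Im ρ| ≤ T₁` have total multiplicity `≤ 4C (log q + log(T + 9/2))` (`T ≥ 0`).
[cite: MontgomeryVaughan2007, Theorem 10.17] -/
theorem sum_order_sdiff_le {C : ℝ}
    (hC : ∀ (q : ℕ) [NeZero q] (χ : DirichletCharacter ℂ q), χ.IsPrimitive → 1 < q →
      ∀ (τ : ℝ) (P : Finset ℂ),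
        (∀ ρ ∈ P, χ.LFunction ρ = 0 ∧ 0 < ρ.re ∧ ρ.re < 1 ∧ |ρ.im - τ| ≤ 1 / 2) →
        ∑ ρ ∈ P, (DirichletDisc.zeroOrder χ ρ : ℝ) ≤ C * (Real.log q + Real.log (|τ| + 4)))
    {q : ℕ} [NeZero q] {χ : DirichletCharacter ℂ q} (hprim : χ.IsPrimitive) (hq : 1 < q)
    {T T₁ : ℝ} (hT : 0 ≤ T) (h2 : T₁ ≤ T + 1) :
    ∑ ρ ∈ (lfunctionZeroBox_finite (ne_one_of_isPrimitive hprim hq) T₁).toFinset \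
        (lfunctionZeroBox_finite (ne_one_of_isPrimitive hprim hq) T).toFinset,
        (DirichletDisc.zeroOrder χ ρ : ℝ) ≤ 4 * C * (Real.log q + Real.log (T + 9 / 2)) := by
  classical
  have hχ : χ ≠ 1 := ne_one_of_isPrimitive hprim hq
  set D := (lfunctionZeroBox_finite hχ T₁).toFinset \ (lfunctionZeroBox_finite hχ T).toFinset with hD
  have hmemD : ∀ ρ ∈ D, χ.LFunction ρ = 0 ∧ 0 < ρ.re ∧ ρ.re < 1 ∧ T < |ρ.im| ∧ |ρ.im| ≤ T₁ := by
    intro ρ hρ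
    rw [hD, Finset.mem_sdiff, Set.Finite.mem_toFinset, Set.Finite.mem_toFinset] at hρ
    obtain ⟨⟨h0, hr0, hr1, hle⟩, hnot⟩ := hρ
    refine ⟨h0, hr0, hr1, ?_, hle⟩
    by_contra hle'
    exact hnot ⟨h0, hr0, hr1, not_lt.1 hle'⟩
  rw [← Finset.sum_filter_add_sum_filter_not D (fun ρ : ℂ ↦ 0 < ρ.im)]
  have habs1 : |T + 1 / 2| + 4 = T + 9 / 2 := by rw [abs_of_nonneg (by linarith)]; ring
  have habs2 : |-(T + 1 / 2)| + 4 = T + 9 / 2 := by rw [abs_neg, abs_of_nonneg (by linarith)]; ring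
  have hpos : ∑ ρ ∈ D.filter (fun ρ : ℂ ↦ 0 < ρ.im), (DirichletDisc.zeroOrder χ ρ : ℝ) ≤
      C * (Real.log q + Real.log (T + 9 / 2)) := by
    have h := hC q χ hprim hq (T + 1 / 2) (D.filter (fun ρ : ℂ ↦ 0 < ρ.im)) fun ρ hρ ↦ by
      rw [Finset.mem_filter] at hρ
      obtain ⟨h0, hr0, hr1, hgt, hle⟩ := hmemD ρ hρ.1
      rw [abs_of_pos hρ.2] at hgt hle
      exact ⟨h0, hr0, hr1, abs_le.2 ⟨by linarith, by linarith⟩⟩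
    rwa [habs1] at h
  have hneg : ∑ ρ ∈ D.filter (fun ρ : ℂ ↦ ¬ 0 < ρ.im), (DirichletDisc.zeroOrder χ ρ : ℝ) ≤
      C * (Real.log q + Real.log (T + 9 / 2)) := by
    have h := hC q χ hprim hq (-(T + 1 / 2)) (D.filter (fun ρ : ℂ ↦ ¬ 0 < ρ.im)) fun ρ hρ ↦ by
      rw [Finset.mem_filter, not_lt] at hρ
      obtain ⟨h0, hr0, hr1, hgt, hle⟩ := hmemD ρ hρ.1
      have him : ρ.im ≠ 0 := by
        intro him
        rw [him, abs_zero] at hgt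
        linarith
      have hneg' : ρ.im < 0 := lt_of_le_of_ne hρ.2 him
      rw [abs_of_neg hneg'] at hgt hle
      exact ⟨h0, hr0, hr1, abs_le.2 ⟨by linarith, by linarith⟩⟩
    rwa [habs2] at h
  have hlog : 0 ≤ Real.log q + Real.log (T + 9 / 2) := by
    have h1 : 0 ≤ Real.log q := Real.log_natCast_nonneg q
    have h2 : 0 ≤ Real.log (T + 9 / 2) := Real.log_nonneg (by linarith)
    linarith
  have hC0 : 0 ≤ C * (Real.log q + Real.log (T + 9 / 2)) := by
    refine le_trans ?_ hpos
    exact Finset.sum_nonneg fun ρ _ ↦ Nat.cast_nonneg _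
  linarith

/-- **The tail of the zero sum** (`x ≥ 1`, `0 < T ≤ T₁`, `χ ≠ χ₀`):
`‖∑_{|Im ρ| ≤ T₁} m(ρ)x^ρ/ρ − ∑_{|Im ρ| ≤ T} m(ρ)x^ρ/ρ‖ ≤ (x/T) ∑_{T < |Im ρ| ≤ T₁} m(ρ)`
(`|x^ρ| = x^{Re ρ} ≤ x`, `|ρ| ≥ |Im ρ| > T`). [cite: MontgomeryVaughan2007, Theorem 12.10 (proof)] -/
theorem norm_charZeroSum_sub_le {q : ℕ} [NeZero q] {χ : DirichletCharacter ℂ q} (hχ : χ ≠ 1)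
    {x T T₁ : ℝ} (hx : 1 ≤ x) (hT : 0 < T) (h1 : T ≤ T₁) :
    ‖charZeroSumTrunc χ x T₁ - charZeroSumTrunc χ x T‖ ≤
      x / T * ∑ ρ ∈ (lfunctionZeroBox_finite hχ T₁).toFinset \ (lfunctionZeroBox_finite hχ T).toFinset,
        (DirichletDisc.zeroOrder χ ρ : ℝ) := by
  classical
  rw [charZeroSumTrunc_eq hχ, charZeroSumTrunc_eq hχ]
  have hsub : (lfunctionZeroBox_finite hχ T).toFinset ⊆ (lfunctionZeroBox_finite hχ T₁).toFinset := by
    intro ρ hρ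
    rw [Set.Finite.mem_toFinset] at hρ ⊢
    exact ⟨hρ.1, hρ.2.1, hρ.2.2.1, hρ.2.2.2.trans h1⟩
  rw [← Finset.sum_sdiff hsub, add_sub_cancel_right, Finset.mul_sum]
  refine (norm_sum_le _ _).trans (Finset.sum_le_sum fun ρ hρ ↦ ?_)
  rw [Finset.mem_sdiff, Set.Finite.mem_toFinset, Set.Finite.mem_toFinset] at hρ
  obtain ⟨⟨h0, hr0, hr1, hle⟩, hnot⟩ := hρ
  have hgt : T < |ρ.im| := by
    by_contra h
    exact hnot ⟨h0, hr0, hr1, not_lt.1 h⟩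
  have hnorm : T ≤ ‖ρ‖ := hgt.le.trans (Complex.abs_im_le_norm ρ)
  rw [norm_mul, Complex.norm_natCast, norm_div, Complex.norm_cpow_eq_rpow_re_of_pos (by linarith)]
  have hxre : x ^ ρ.re ≤ x := by
    calc x ^ ρ.re ≤ x ^ (1 : ℝ) := Real.rpow_le_rpow_of_exponent_le hx hr1.le
      _ = x := Real.rpow_one x
  have hm0 : (0 : ℝ) ≤ DirichletDisc.zeroOrder χ ρ := Nat.cast_nonneg _
  calc (DirichletDisc.zeroOrder χ ρ : ℝ) * (x ^ ρ.re / ‖ρ‖) ≤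
      (DirichletDisc.zeroOrder χ ρ : ℝ) * (x / T) := by
        refine mul_le_mul_of_nonneg_left ?_ hm0
        exact div_le_div₀ (by linarith) hxre hT hnorm
    _ = x / T * (DirichletDisc.zeroOrder χ ρ : ℝ) := by ring

end ExplicitPsiChar

end Literature.NumberTheory.LFunctions

end
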